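import Mathlib.Analysis.Meromorphic.Order
import Mathlib.Analysis.Analytic.IsolatedZeros
import Mathlib.Analysis.Analytic.Constructions
import Mathlib.Analysis.Calculus.Deriv.Inv
import Mathlib.Analysis.Complex.Basic

/-!
# The order of a zero is invariant under the chart change `w = 1/z`
(helper `helper_meromorphicOrderAt_comp_inv` of line `cross-cap-laurent`, crux
`GromovRecognitionRelEnd`, item stmt-SmoothPoincare4-11009)

Intersections of a two-chart `J`-holomorphic sphere (`u v : ℂ → X`, `v w = u w⁻¹`) with a sphere
at infinity `{T = 0}` are counted as zeros of the holomorphic functions `f = T ∘ u` and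
`g = T ∘ v = f ∘ (·)⁻¹`; along families the zeros migrate between the two charts, so their
multiplicity has to be chart-independent: for `w₀ ≠ 0`,
`ord_{w₀} (w ↦ f w⁻¹) = ord_{w₀⁻¹} f`.

Proof: the inversion `w ↦ w⁻¹` is analytic at `w₀ ≠ 0` with derivative `-(w₀ ^ 2)⁻¹ ≠ 0`, and the
meromorphic order is invariant under precomposition with an analytic change of variable with
non-vanishing derivative (`meromorphicOrderAt_comp_of_deriv_ne_zero`). The analyticity hypothesis
on `f` of the registered signature is not used by the proof.

References: standard complex analysis (folklore); D. McDuff, D. Salamon, *J-holomorphic Curves and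
Symplectic Topology*, 2nd ed. (2012), §4.2 (spheres through the two charts `z`, `1/z`).
No definitions, notation or instances.
-/

-- the prescribed namespace `Summit.<P>.<Sub>.…` duplicates `SmoothPoincare4` (P = Sub)
set_option linter.dupNamespace false

namespace Summit.SmoothPoincare4.SmoothPoincare4.Theorems.GromovRecognitionRelEnd.CrossCapLaurent

/-- **The order of a zero is invariant under the chart change `w = 1/z`.**
For `w₀ ≠ 0` the meromorphic order of `w ↦ f w⁻¹` at `w₀` equals the meromorphic order of `f` at
`w₀⁻¹`: the inversion is an analytic change of variable at `w₀` with derivative `-(w₀ ^ 2)⁻¹ ≠ 0`.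
(The analyticity hypothesis on `f` is part of the registered signature but not needed.)
[folklore] -/
theorem helper_meromorphicOrderAt_comp_inv : ∀ (f : ℂ → ℂ) (w₀ : ℂ), w₀ ≠ 0 → AnalyticAt ℂ f w₀⁻¹ → meromorphicOrderAt (fun w : ℂ => f w⁻¹) w₀ = meromorphicOrderAt f w₀⁻¹ := by
  intro f w₀ hw₀ _
  -- the inversion is analytic at `w₀ ≠ 0` with non-vanishing derivative
  have hg : AnalyticAt ℂ (fun w : ℂ => w⁻¹) w₀ := analyticAt_inv hw₀
  have hg' : deriv (fun w : ℂ => w⁻¹) w₀ ≠ 0 := by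
    rw [deriv_inv]
    exact neg_ne_zero.mpr (inv_ne_zero (pow_ne_zero 2 hw₀))
  -- invariance of the meromorphic order under such a change of variable
  have h := meromorphicOrderAt_comp_of_deriv_ne_zero (f := f) hg hg'
  simpa only [Function.comp_def] using h

end Summit.SmoothPoincare4.SmoothPoincare4.Theorems.GromovRecognitionRelEnd.CrossCapLaurent
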